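import Summits.AtomisticToContinuum.HydrodynamicLimit.Theorems.ImplosionDichotomyPolynomialCompressionContinuation
import Summits.AtomisticToContinuum.HydrodynamicLimit.Theorems.ImplosionDichotomyPolynomialCompressionUniqueness

/-!
# `stub_conditionalExistence` reduced to local existence and continuation

Helper file for the line `log-lipschitz-budget` of the crux
`ImplosionDichotomy.PolynomialCompression` (stmt-AtomisticToContinuum-12587), stub
`stub_conditionalExistence` (Kato/Majda existence on a prescribed horizon `[0, T')` from a-priori
bounds, for the hard-sphere Euler system with the equation of state unbundled as
`η₀, F` analytic, `hsExcessFreeEnergy = F` on `[0, η₀)`). The stub is (a) local existence +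
(b) continuation + (c) uniqueness + the soft gluing argument. (c) is
`hsEuler_unique_of_analytic_eos` (`…Uniqueness.lean`); the gluing argument is
`isHardSphereEulerSolution_exists_of_apriori` (`…Continuation.lean`), whose uniqueness hypothesis
is however UNCONDITIONAL. This file closes the gap:

* `isHardSphereEulerSolution_exists_of_apriori_of_unique_data` — the gluing argument with
  uniqueness required only for pairs of solutions WITH THE GIVEN DATA on horizons `T ≤ T'`
  (that is all the proof uses);
* `hsEuler_exists_of_local_and_continuation` — **what remains of the stub**: under the stub's
  equation-of-state hypotheses there is `η₁ > 0` such that, for every `σ > 0`, data, horizon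
  `T' > 0` and bound `M > 0`, local existence (a) for the data and continuation (b) of solutions
  with the data obeying the stub's a-priori bounds, together with the stub's a-priori hypothesis
  (every solution with the data on `[0, T)`, `T ≤ T'`, obeys the bounds, among them
  `ρσ³ ≤ η₁`), yield a classical solution with the data on `[0, T')`. Inputs (a) and (b) are
  Kato 1975 / Majda 1984 (symmetric-hyperbolic `H^s` theory), not in the tree.
-/

namespace Summit.AtomisticToContinuum.HydrodynamicLimit.Theorems

open Set
open Literature.MathematicalPhysics.KineticTheory Literature.Analysis.FunctionSpaces

/-- **Existence on a prescribed horizon from a-priori bounds, with uniqueness only among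
solutions with the given data** (soft continuation argument; variant of
`isHardSphereEulerSolution_exists_of_apriori` in which hypothesis (c) is asked only for pairs of
classical solutions on a common `[0, T)`, `T ≤ T'`, both having the data `(ρ₀, u₀, θ₀)` — which
is all the gluing uses). [folklore] -/
theorem isHardSphereEulerSolution_exists_of_apriori_of_unique_data :
    ∀ {σ T' : ℝ} {ρ₀ θ₀ : T3 → ℝ} {u₀ : T3 → V3}
      (P : ℝ → (ℝ → T3 → ℝ) → (ℝ → T3 → V3) → (ℝ → T3 → ℝ) → Prop), 0 < T' →
      (∃ T : ℝ, 0 < T ∧ ∃ (ρ θ : ℝ → T3 → ℝ) (u : ℝ → T3 → V3),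
        IsHardSphereEulerSolution σ T ρ u θ ∧ ρ 0 = ρ₀ ∧ u 0 = u₀ ∧ θ 0 = θ₀) →
      (∀ T : ℝ, T ≤ T' → ∀ (ρ₁ θ₁ : ℝ → T3 → ℝ) (u₁ : ℝ → T3 → V3) (ρ₂ θ₂ : ℝ → T3 → ℝ)
        (u₂ : ℝ → T3 → V3),
        IsHardSphereEulerSolution σ T ρ₁ u₁ θ₁ → IsHardSphereEulerSolution σ T ρ₂ u₂ θ₂ →
        ρ₁ 0 = ρ₀ → u₁ 0 = u₀ → θ₁ 0 = θ₀ → ρ₂ 0 = ρ₀ → u₂ 0 = u₀ → θ₂ 0 = θ₀ →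
        ∀ t ∈ Ico 0 T, ρ₁ t = ρ₂ t ∧ u₁ t = u₂ t ∧ θ₁ t = θ₂ t) →
      (∀ T : ℝ, 0 < T → T < T' → ∀ (ρ θ : ℝ → T3 → ℝ) (u : ℝ → T3 → V3),
        IsHardSphereEulerSolution σ T ρ u θ → ρ 0 = ρ₀ → u 0 = u₀ → θ 0 = θ₀ → P T ρ u θ →
        ∃ T₂ : ℝ, T < T₂ ∧ ∃ (ρ' θ' : ℝ → T3 → ℝ) (u' : ℝ → T3 → V3),
          IsHardSphereEulerSolution σ T₂ ρ' u' θ' ∧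
          ∀ t ∈ Ico 0 T, ρ' t = ρ t ∧ u' t = u t ∧ θ' t = θ t) →
      (∀ T : ℝ, T ≤ T' → ∀ (ρ θ : ℝ → T3 → ℝ) (u : ℝ → T3 → V3),
        IsHardSphereEulerSolution σ T ρ u θ → ρ 0 = ρ₀ → u 0 = u₀ → θ 0 = θ₀ → P T ρ u θ) →
      ∃ (ρ θ : ℝ → T3 → ℝ) (u : ℝ → T3 → V3),
        IsHardSphereEulerSolution σ T' ρ u θ ∧ ρ 0 = ρ₀ ∧ u 0 = u₀ ∧ θ 0 = θ₀ := by
  -- adapted from `isHardSphereEulerSolution_exists_of_apriori` (…Continuation.lean)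
  intro σ T' ρ₀ θ₀ u₀ P hT' hloc huniq hcont hbd
  classical
  -- the set of horizons `T ≤ T'` carrying a classical solution with the data
  set S : Set ℝ := {T | T ≤ T' ∧ ∃ (ρ θ : ℝ → T3 → ℝ) (u : ℝ → T3 → V3),
    IsHardSphereEulerSolution σ T ρ u θ ∧ ρ 0 = ρ₀ ∧ u 0 = u₀ ∧ θ 0 = θ₀} with hS
  have hbdd : BddAbove S := ⟨T', fun T hT => hT.1⟩
  obtain ⟨T₀, hT₀, ρa, θa, ua, ha, hρa, hua, hθa⟩ := hloc
  have hT₀S : min T₀ T' ∈ S :=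
    ⟨min_le_right _ _, ρa, θa, ua, isHardSphereEulerSolution_restrict ha (min_le_left _ _),
      hρa, hua, hθa⟩
  have hne : S.Nonempty := ⟨_, hT₀S⟩
  set Ts : ℝ := sSup S with hTs
  have hTs_le : Ts ≤ T' := csSup_le hne fun T hT => hT.1
  have hTs_pos : 0 < Ts := lt_of_lt_of_le (lt_min hT₀ hT') (le_csSup hbdd hT₀S)
  -- a solution with the data on every horizon of `S` (choice)
  have hS2 : ∀ T ∈ S, ∃ (ρ θ : ℝ → T3 → ℝ) (u : ℝ → T3 → V3),
      IsHardSphereEulerSolution σ T ρ u θ ∧ ρ 0 = ρ₀ ∧ u 0 = u₀ ∧ θ 0 = θ₀ := fun T hT => hT.2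
  choose ρf θf uf hsol hρ0 hu0 hθ0 using hS2
  -- every `t < Ts` lies below some horizon of `S` (choice)
  have hex : ∀ t : ℝ, t < Ts → ∃ T ∈ S, t < T := fun t ht => exists_lt_of_lt_csSup hne ht
  choose Tof hTofS htTof using hex
  -- the glued fields on `[0, Ts)`
  set ρs : ℝ → T3 → ℝ := fun t => if h : t < Ts then ρf (Tof t h) (hTofS t h) t else ρ₀ with hρs
  set us : ℝ → T3 → V3 := fun t => if h : t < Ts then uf (Tof t h) (hTofS t h) t else u₀ with hus
  set θs : ℝ → T3 → ℝ := fun t => if h : t < Ts then θf (Tof t h) (hTofS t h) t else θ₀ with hθs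
  -- by uniqueness (among solutions with the data) the glued fields agree with every chosen
  -- solution on its horizon
  have hagree : ∀ (T : ℝ) (hT : T ∈ S), ∀ t ∈ Ico 0 T, t < Ts →
      ρs t = ρf T hT t ∧ us t = uf T hT t ∧ θs t = θf T hT t := by
    intro T hT t ht htTs
    have h₁ : ρs t = ρf (Tof t htTs) (hTofS t htTs) t := by simp only [hρs, dif_pos htTs]
    have h₂ : us t = uf (Tof t htTs) (hTofS t htTs) t := by simp only [hus, dif_pos htTs]
    have h₃ : θs t = θf (Tof t htTs) (hTofS t htTs) t := by simp only [hθs, dif_pos htTs]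
    have hmin : t ∈ Ico 0 (min (Tof t htTs) T) := ⟨ht.1, lt_min (htTof t htTs) ht.2⟩
    have hu := huniq (min (Tof t htTs) T) ((min_le_right _ _).trans hT.1)
      (ρf _ (hTofS t htTs)) (θf _ (hTofS t htTs))
      (uf _ (hTofS t htTs)) (ρf T hT) (θf T hT) (uf T hT)
      (isHardSphereEulerSolution_restrict (hsol _ (hTofS t htTs)) (min_le_left _ _))
      (isHardSphereEulerSolution_restrict (hsol T hT) (min_le_right _ _))
      (hρ0 _ _) (hu0 _ _) (hθ0 _ _) (hρ0 _ _) (hu0 _ _) (hθ0 _ _) t hmin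
    exact ⟨h₁.trans hu.1, h₂.trans hu.2.1, h₃.trans hu.2.2⟩
  -- hence they are a classical solution on `[0, Ts)` (gluing) …
  have hsolTs : IsHardSphereEulerSolution σ Ts ρs us θs := by
    refine isHardSphereEulerSolution_of_forall_lt fun T hT => ?_
    obtain ⟨T₃, hT₃S, hTT₃⟩ := exists_lt_of_lt_csSup hne hT
    refine isHardSphereEulerSolution_congr
      (isHardSphereEulerSolution_restrict (hsol T₃ hT₃S) hTT₃.le)
      (fun t ht => ?_) (fun t ht => ?_) (fun t ht => ?_)
    · exact (hagree T₃ hT₃S t ⟨ht.1, ht.2.trans hTT₃⟩ (ht.2.trans hT)).1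
    · exact (hagree T₃ hT₃S t ⟨ht.1, ht.2.trans hTT₃⟩ (ht.2.trans hT)).2.1
    · exact (hagree T₃ hT₃S t ⟨ht.1, ht.2.trans hTT₃⟩ (ht.2.trans hT)).2.2
  -- … with the prescribed data
  have hρs0 : ρs 0 = ρ₀ := by
    have h : ρs 0 = ρf (Tof 0 hTs_pos) (hTofS 0 hTs_pos) 0 := by simp only [hρs, dif_pos hTs_pos]
    rw [h, hρ0]
  have hus0 : us 0 = u₀ := by
    have h : us 0 = uf (Tof 0 hTs_pos) (hTofS 0 hTs_pos) 0 := by simp only [hus, dif_pos hTs_pos]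
    rw [h, hu0]
  have hθs0 : θs 0 = θ₀ := by
    have h : θs 0 = θf (Tof 0 hTs_pos) (hTofS 0 hTs_pos) 0 := by simp only [hθs, dif_pos hTs_pos]
    rw [h, hθ0]
  -- if `Ts < T'`, the a-priori bounds and continuation push the horizon beyond `sup S`: absurd
  have hTs_eq : Ts = T' := by
    by_contra hne'
    have hlt : Ts < T' := lt_of_le_of_ne hTs_le hne'
    have hP := hbd Ts hTs_le ρs θs us hsolTs hρs0 hus0 hθs0
    obtain ⟨T₂, hTsT₂, ρ', θ', u', hsol', hagr'⟩ :=
      hcont Ts hTs_pos hlt ρs θs us hsolTs hρs0 hus0 hθs0 hP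
    have h0 : (0 : ℝ) ∈ Ico 0 Ts := ⟨le_rfl, hTs_pos⟩
    have hmem : min T₂ T' ∈ S :=
      ⟨min_le_right _ _, ρ', θ', u', isHardSphereEulerSolution_restrict hsol' (min_le_left _ _),
        by rw [(hagr' 0 h0).1, hρs0], by rw [(hagr' 0 h0).2.1, hus0],
        by rw [(hagr' 0 h0).2.2, hθs0]⟩
    exact absurd (le_csSup hbdd hmem) (not_le.2 (lt_min hTsT₂ hlt))
  exact ⟨ρs, θs, us, hTs_eq ▸ hsolTs, hρs0, hus0, hθs0⟩

/-- **`stub_conditionalExistence` from local existence and continuation.** Under the stub's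
equation-of-state hypotheses (`η₀ > 0`, `F` analytic on `(-η₀, η₀)`, `hsExcessFreeEnergy = F` on
`[0, η₀)`) there is a packing threshold `η₁ > 0` such that for every reduced diameter `σ > 0`,
data `(ρ₀, u₀, θ₀)`, horizon `T' > 0` and bound `M > 0`: IF (a) some classical solution with the
data exists on some `[0, T)`, `T > 0`, and (b) every classical solution with the data on
`[0, T)`, `0 < T < T'`, obeying the stub's a-priori bounds extends to a classical solution on a
strictly longer interval agreeing with it on `[0, T)`, THEN the stub's a-priori hypothesis (every
classical solution with the data on `[0, T)`, `T ≤ T'`, obeys the bounds, among them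
`ρσ³ ≤ η₁`) yields a classical solution with the data on `[0, T')`. Uniqueness (c) is supplied by
`hsEuler_unique_of_analytic_eos`, the gluing by
`isHardSphereEulerSolution_exists_of_apriori_of_unique_data`; (a), (b) are the Kato/Majda inputs.
[folklore] -/
theorem hsEuler_exists_of_local_and_continuation :
    ∀ η₀ : ℝ, 0 < η₀ → ∀ F : ℝ → ℝ, AnalyticOnNhd ℝ F (Ioo (-η₀) η₀) →
      EqOn hsExcessFreeEnergy F (Ico 0 η₀) →
      ∃ η₁ : ℝ, 0 < η₁ ∧ ∀ σ : ℝ, 0 < σ →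
        ∀ (ρ₀ θ₀ : T3 → ℝ) (u₀ : T3 → V3) (T' M : ℝ), 0 < T' → 0 < M →
          (∃ T : ℝ, 0 < T ∧ ∃ (ρ θ : ℝ → T3 → ℝ) (u : ℝ → T3 → V3),
            IsHardSphereEulerSolution σ T ρ u θ ∧ ρ 0 = ρ₀ ∧ u 0 = u₀ ∧ θ 0 = θ₀) →
          (∀ T : ℝ, 0 < T → T < T' → ∀ (ρ θ : ℝ → T3 → ℝ) (u : ℝ → T3 → V3),
            IsHardSphereEulerSolution σ T ρ u θ → ρ 0 = ρ₀ → u 0 = u₀ → θ 0 = θ₀ →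
            (∀ t ∈ Ico 0 T, ∀ x,
              M⁻¹ ≤ ρ t x ∧ ρ t x ≤ M ∧ M⁻¹ ≤ θ t x ∧ θ t x ≤ M ∧ ‖u t x‖ ≤ M ∧
              ρ t x * σ ^ 3 ≤ η₁ ∧
              ∀ i : Fin 3, ‖Torus.partialDeriv i (u t) x‖ ≤ M ∧
                |Torus.partialDeriv i (ρ t) x| ≤ M ∧ |Torus.partialDeriv i (θ t) x| ≤ M) →
            ∃ T₂ : ℝ, T < T₂ ∧ ∃ (ρ' θ' : ℝ → T3 → ℝ) (u' : ℝ → T3 → V3),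
              IsHardSphereEulerSolution σ T₂ ρ' u' θ' ∧
              ∀ t ∈ Ico 0 T, ρ' t = ρ t ∧ u' t = u t ∧ θ' t = θ t) →
          (∀ T : ℝ, T ≤ T' → ∀ (ρ θ : ℝ → T3 → ℝ) (u : ℝ → T3 → V3),
            IsHardSphereEulerSolution σ T ρ u θ → ρ 0 = ρ₀ → u 0 = u₀ → θ 0 = θ₀ →
            ∀ t ∈ Ico 0 T, ∀ x,
              M⁻¹ ≤ ρ t x ∧ ρ t x ≤ M ∧ M⁻¹ ≤ θ t x ∧ θ t x ≤ M ∧ ‖u t x‖ ≤ M ∧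
              ρ t x * σ ^ 3 ≤ η₁ ∧
              ∀ i : Fin 3, ‖Torus.partialDeriv i (u t) x‖ ≤ M ∧
                |Torus.partialDeriv i (ρ t) x| ≤ M ∧ |Torus.partialDeriv i (θ t) x| ≤ M) →
          ∃ (ρ θ : ℝ → T3 → ℝ) (u : ℝ → T3 → V3),
            IsHardSphereEulerSolution σ T' ρ u θ ∧ ρ 0 = ρ₀ ∧ u 0 = u₀ ∧ θ 0 = θ₀ := by
  intro η₀ hη₀ F hF hEq
  obtain ⟨η₁, hη₁, huniq⟩ := hsEuler_unique_of_analytic_eos η₀ hη₀ F hF hEq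
  refine ⟨η₁, hη₁, fun σ hσ ρ₀ θ₀ u₀ T' M hT' _hM hloc hcont hbd => ?_⟩
  refine isHardSphereEulerSolution_exists_of_apriori_of_unique_data
    (fun T ρ u θ => ∀ t ∈ Ico 0 T, ∀ x,
      M⁻¹ ≤ ρ t x ∧ ρ t x ≤ M ∧ M⁻¹ ≤ θ t x ∧ θ t x ≤ M ∧ ‖u t x‖ ≤ M ∧
      ρ t x * σ ^ 3 ≤ η₁ ∧
      ∀ i : Fin 3, ‖Torus.partialDeriv i (u t) x‖ ≤ M ∧
        |Torus.partialDeriv i (ρ t) x| ≤ M ∧ |Torus.partialDeriv i (θ t) x| ≤ M)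
    hT' hloc (fun T hT ρ₁ θ₁ u₁ ρ₂ θ₂ u₂ h₁ h₂ hρ₁ hu₁ hθ₁ hρ₂ hu₂ hθ₂ => ?_) hcont hbd
  have hpk₁ : ∀ t ∈ Ico 0 T, ∀ x, ρ₁ t x * σ ^ 3 ≤ η₁ := fun t ht x =>
    (hbd T hT ρ₁ θ₁ u₁ h₁ hρ₁ hu₁ hθ₁ t ht x).2.2.2.2.2.1
  have hpk₂ : ∀ t ∈ Ico 0 T, ∀ x, ρ₂ t x * σ ^ 3 ≤ η₁ := fun t ht x =>
    (hbd T hT ρ₂ θ₂ u₂ h₂ hρ₂ hu₂ hθ₂ t ht x).2.2.2.2.2.1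
  exact huniq σ hσ T ρ₁ θ₁ u₁ ρ₂ θ₂ u₂ h₁ h₂ hpk₁ hpk₂ (hρ₁.trans hρ₂.symm) (hu₁.trans hu₂.symm)
    (hθ₁.trans hθ₂.symm)

end Summit.AtomisticToContinuum.HydrodynamicLimit.Theorems
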